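import Literature.Geometry.Kaehler.LelongModelCore
import HarnessLib

/-!
# Lelong's theorem in the model space

The local form of Lelong's theorem ([Chirka1989, §14.1 Thm.],
`Literature/Geometry/Kaehler/HolomorphicChainFacts.lean`) in a finite-dimensional complex normed
space `E`: **if `A` is cut out by holomorphic equations near `a` and all regular points of `A`
near `a` have codimension `≥ dim E - p` (i.e. `dim_a A ≤ p`), then `𝓗^{2p}(A ∩ U) < ∞` for some
neighbourhood `U` of `a`** (`Literature.Geometry.Kaehler.SCV.exists_nhds_hausdorffMeasure_lt_top`).

The proof is by induction on `p`. In dimension `dim E = p + (m + 1)`,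
`Literature.Geometry.Kaehler.SCV.exists_nhds_good_lt_top`
(`Literature/Geometry/Kaehler/LelongModelCore.lean`) bounds the `𝓗^{2p}`-measure of the part
of `A` near `a` lying over the complement of the discriminant `{Δ = 0}` of a local analytic
cover; the part over `{Δ = 0}` is again cut out by holomorphic equations near `a` and has
dimension `≤ p - 1` at its regular points
(`Literature.Geometry.Kaehler.SCV.finrank_lt_of_isRegPt_of_discriminant`), so by induction it
has locally finite `𝓗^{2p-2}`-measure, hence `𝓗^{2p}`-measure zero
(`MeasureTheory.Measure.hausdorffMeasure_zero_or_top`). This replaces the printed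
"`𝓗_{2p}(sng A) = 0` since `dim sng A < p`" ([Chirka1989, §14.1, §3.7]). The base case
`p = 0`: an isolating plane of dimension `dim E` makes `a` an isolated point of `A`.

## References

* E. M. Chirka, *Complex Analytic Sets*, Kluwer 1989, §3.7, §14.1 Thm. [Chirka1989].
-/

open scoped ENNReal NNReal Topology
open Metric Set Filter Function MeasureTheory MeasureTheory.Measure
open Literature.Geometry.GeometricMeasureTheory

namespace Literature.Geometry.Kaehler

namespace SCV

open Literature.Analysis.Complex.SCV

variable {E : Type*} [NormedAddCommGroup E] [NormedSpace ℂ E]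

/-- The zero locus `{x | Δ (Θ x).1 = 0}` of a function holomorphic on a ball of the base, pulled
back along linear coordinates `Θ`, is cut out by one holomorphic equation near every point over
the ball. [folklore] -/
theorem isZeroSetAt_preimage_discriminant {m : ℕ} {K : Submodule ℂ E}
    (Θ : E ≃L[ℂ] (K × (Fin (m + 1) → ℂ))) {c : K} {ε : ℝ} {Δ : K → ℂ}
    (hΔd : DifferentiableOn ℂ Δ (ball c ε)) {x : E} (hx : (Θ x).1 ∈ ball c ε) :
    IsZeroSetAt {y : E | Δ (Θ y).1 = 0} x := by
  set O : Set E := (fun y : E => (Θ y).1) ⁻¹' ball c ε with hO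
  have hOo : IsOpen O := isOpen_ball.preimage (continuous_fst.comp Θ.continuous)
  refine ⟨O, hOo, hx, 1, fun y _ => Δ (Θ y).1, ?_, ?_⟩
  · have h1 : DifferentiableOn ℂ (fun y : E => Δ (Θ y).1) O :=
      hΔd.comp ((Θ : E →L[ℂ] K × (Fin (m + 1) → ℂ)).differentiableOn.fst) fun y hy => hy
    exact differentiableOn_pi.2 fun _ => h1
  · ext y
    simp only [mem_inter_iff, mem_setOf_eq, mem_preimage, mem_singleton_iff, funext_iff,
      Pi.zero_apply, forall_const]
    exact and_comm

variable [FiniteDimensional ℂ E] [MeasurableSpace E] [BorelSpace E]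

/-- **Lelong's theorem, local model form** ([Chirka1989, §14.1 Thm.] in a chart): let `A ⊆ E`
be cut out by holomorphic equations near `a`, and suppose all regular points of `A` near `a`
have codimension `≥ dim E - p`. Then `a` has a neighbourhood `U` with `𝓗^{2p}(A ∩ U) < ∞`
(`𝓗 = μH`, the Hausdorff measure of the norm of `E`). By induction on `p`: the part of `A` over
the complement of the discriminant of a local analytic cover has finite measure
(`exists_nhds_good_lt_top`), the part over the discriminant has dimension `≤ p - 1`
(`finrank_lt_of_isRegPt_of_discriminant`) hence, by induction, `𝓗^{2p}`-measure zero.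
[cite: Chirka1989, §14.1 Thm., p. 174] -/
theorem exists_nhds_hausdorffMeasure_lt_top (p : ℕ) :
    ∀ {A : Set E} {a : E}, IsZeroSetAt A a →
      (∀ᶠ x in 𝓝 a, x ∈ A → ∀ q, IsRegPt A q x → Module.finrank ℂ E ≤ q + p) →
      ∃ U ∈ 𝓝 a, μH[2 * p] (A ∩ U) < ∞ := by
  -- off `A` a whole neighbourhood misses `A`
  have hoff : ∀ (d : ℝ) {A : Set E} {a : E}, IsZeroSetAt A a → a ∉ A →
      ∃ U ∈ 𝓝 a, μH[d] (A ∩ U) < ∞ := by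
    intro d A a hA haA
    obtain ⟨U, hU, haU, N, g, hg, hAU⟩ := hA
    have hga : g a ≠ 0 := fun h0 => haA (hAU.symm.subset ⟨haU, h0⟩).1
    refine ⟨U ∩ g ⁻¹' {0}ᶜ,
      (hg.continuousOn.isOpen_inter_preimage hU isOpen_compl_singleton).mem_nhds ⟨haU, hga⟩, ?_⟩
    have hempty : A ∩ (U ∩ g ⁻¹' {0}ᶜ) = ∅ := by
      ext x
      simp only [mem_inter_iff, mem_preimage, mem_compl_iff, mem_singleton_iff,
        mem_empty_iff_false, iff_false, not_and, not_not]
      intro hxA hxU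
      exact (hAU.subset ⟨hxA, hxU⟩).2
    rw [hempty, measure_empty]
    exact ENNReal.zero_lt_top
  induction p with
  | zero =>
    intro A a hA hdim
    by_cases haA : a ∈ A
    swap
    · exact hoff _ hA haA
    -- an isolating plane of full dimension: `a` is isolated in `A`
    obtain ⟨ι, hι, -, hiso⟩ := exists_isolating_plane hA haA hdim ⊥ (by simp) (Nat.zero_le _)
    have hdimeq : Module.finrank ℂ (Fin (Module.finrank ℂ E - 0) → ℂ) = Module.finrank ℂ E := by
      simp
    have hsurj : Surjective ι :=
      (LinearMap.injective_iff_surjective_of_finrank_eq_finrank hdimeq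
        (f := (ι : (Fin (Module.finrank ℂ E - 0) → ℂ) →ₗ[ℂ] E))).1 hι
    set e : (Fin (Module.finrank ℂ E - 0) → ℂ) ≃L[ℂ] E :=
      ContinuousLinearEquiv.ofBijective ι (LinearMap.ker_eq_bot.2 hι)
        (LinearMap.range_eq_top.2 hsurj) with he
    have hecoe : ∀ w, e w = ι w := fun w => rfl
    have ht : Tendsto (fun x : E => e.symm (x - a)) (𝓝[≠] a) (𝓝[≠] 0) := by
      refine tendsto_nhdsWithin_of_tendsto_nhds_of_eventually_within _ ?_ ?_
      · have hc : Continuous fun x : E => e.symm (x - a) :=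
          e.symm.continuous.comp (continuous_id.sub continuous_const)
        have := hc.tendsto a
        rw [sub_self, map_zero] at this
        exact this.mono_left nhdsWithin_le_nhds
      · refine eventually_nhdsWithin_of_forall fun x hx h0 => hx ?_
        have : x - a = 0 := by
          have h1 := congrArg e h0
          rwa [e.apply_symm_apply, map_zero] at h1
        exact sub_eq_zero.1 this
    have hev : ∀ᶠ x in 𝓝[≠] a, x ∉ A := by
      filter_upwards [ht.eventually hiso] with x hx
      rwa [← hecoe, e.apply_symm_apply, add_sub_cancel] at hx
    obtain ⟨U, hU, hUA⟩ : ∃ U ∈ 𝓝 a, ∀ x ∈ U, x ≠ a → x ∉ A := by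
      rw [eventually_nhdsWithin_iff] at hev
      exact ⟨_, hev, fun x hx hxa => hx hxa⟩
    refine ⟨U, hU, lt_of_le_of_lt (hausdorffMeasure_le_one_of_subsingleton ?_ (by positivity))
      ENNReal.one_lt_top⟩
    intro x hx y hy
    have hxa : x = a := by_contra fun h => hUA x hx.2 h hx.1
    have hya : y = a := by_contra fun h => hUA y hy.2 h hy.1
    rw [hxa, hya]
  | succ p ih =>
    intro A a hA hdim
    by_cases haA : a ∈ A
    swap
    · exact hoff _ hA haA
    -- trivial dimensions
    by_cases hnp : Module.finrank ℂ E ≤ p + 1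
    · refine ⟨ball a 1, ball_mem_nhds a one_pos, ?_⟩
      have hb : Bornology.IsBounded (A ∩ ball a 1) := isBounded_ball.subset inter_subset_right
      rcases hnp.lt_or_eq with hlt | heq
      · rw [hausdorffMeasure_two_mul_eq_zero_of_finrank_lt hlt]
        exact ENNReal.zero_lt_top
      · have h := hausdorffMeasure_two_mul_lt_top_of_isBounded (W := E) hb
        rw [heq] at h
        exact h
    -- the main case `dim E = (p + 1) + (m + 1)`
    obtain ⟨m, hm⟩ : ∃ m, Module.finrank ℂ E = (p + 1) + (m + 1) :=
      ⟨Module.finrank ℂ E - (p + 1) - 1, by omega⟩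
    obtain ⟨V, K, Θ, ε, r, Kb, Δ, hVo, haV, hdimK, hVtube, hfib, hΔd, hΔne, hgood⟩ :=
      exists_nhds_good_lt_top hm hA haA hdim
    -- the part over the discriminant
    set B : Set E := {x | x ∈ A ∩ V ∧ Δ (Θ x).1 = 0} with hB
    have hBzero : IsZeroSetAt B a := by
      have h1 : IsZeroSetAt (A ∩ V) a := hA.inter (IsZeroSetAt.of_mem_nhds (hVo.mem_nhds haV))
      have h2 : IsZeroSetAt {y : E | Δ (Θ y).1 = 0} a :=
        isZeroSetAt_preimage_discriminant Θ hΔd (hVtube a haV).1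
      have h3 := h1.inter h2
      exact h3
    have hBdim : ∀ᶠ x in 𝓝 a, x ∈ B → ∀ q, IsRegPt B q x → Module.finrank ℂ E ≤ q + p := by
      refine Filter.Eventually.of_forall fun x hxB q hq => ?_
      have hlt := finrank_lt_of_isRegPt_of_discriminant (A := A) (B := B) (a := a) Θ hfib hΔne
        (fun y hy => hy.1.1) (fun y hy => ⟨(hVtube y hy.1.2).1, (hVtube y hy.1.2).2, hy.2⟩)
        hxB hq
      omega
    obtain ⟨UB, hUB, hBfin⟩ := ih hBzero hBdim
    have hBnull : μH[2 * (p + 1 : ℕ)] (B ∩ UB) = 0 := by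
      have hlt : (2 * p : ℝ) < 2 * (p + 1 : ℕ) := by push_cast; linarith
      rcases hausdorffMeasure_zero_or_top hlt (B ∩ UB) with h | h
      · exact h
      · exact absurd h hBfin.ne
    -- assembling
    refine ⟨V ∩ UB, inter_mem (hVo.mem_nhds haV) hUB, ?_⟩
    have hsub : A ∩ (V ∩ UB) ⊆ {x | x ∈ A ∩ V ∧ Δ (Θ x).1 ≠ 0} ∪ (B ∩ UB) := by
      rintro x ⟨hxA, hxV, hxUB⟩
      by_cases hΔx : Δ (Θ x).1 = 0
      · exact Or.inr ⟨⟨⟨hxA, hxV⟩, hΔx⟩, hxUB⟩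
      · exact Or.inl ⟨⟨hxA, hxV⟩, hΔx⟩
    calc μH[2 * (p + 1 : ℕ)] (A ∩ (V ∩ UB))
        ≤ μH[2 * (p + 1 : ℕ)] ({x | x ∈ A ∩ V ∧ Δ (Θ x).1 ≠ 0} ∪ (B ∩ UB)) := measure_mono hsub
      _ ≤ μH[2 * (p + 1 : ℕ)] {x | x ∈ A ∩ V ∧ Δ (Θ x).1 ≠ 0} + μH[2 * (p + 1 : ℕ)] (B ∩ UB) :=
          measure_union_le _ _
      _ < ∞ := by
          rw [hBnull, add_zero]
          exact hgood

end SCV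

end Literature.Geometry.Kaehler
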